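import Literature.NumberTheory.Automorphic.UnitaryGroupBorelHeight
import Literature.NumberTheory.Automorphic.GLnAdelicStructure
import Literature.NumberTheory.Automorphic.AdelicPrimitiveVectorNormalForm
import Mathlib.Topology.Algebra.Group.Matrix
import HarnessLib

/-!
# The Borel height `H : U(J_N)(𝔸_F) → ℝ_{>0}` is continuous; the cut-off sets `{H > T}` are open
(Garrett, *Modern Analysis of Automorphic Forms by Example* (2018), §2.2: heights are products of
local heights, the finite ones invariant under `GL_n(𝒪_v)`; Mœglin–Waldspurger (1995), I.2.2)

Topic `NumberTheory/Automorphic`; namespace `Literature.NumberTheory.Automorphic.UnitaryGroup`. THEOREMS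
ONLY over accepted tree modules: no definition, no named fact, no `sorry`, no instance, no notation.

The T1-qs letters cut off Arthur's kernels and constant terms by the multiplicative Iwasawa height
`borelHeight g = h(e_N g)⁻¹` of ★ `UnitaryGroupBorelHeight` (`h = vecHeight`, the Godement–Garrett
height of the last row of `g ∈ U(J_N)(𝔸_F) ≤ GL_N(𝔸_E)`). This file proves the height is
CONTINUOUS, so that the cut-offs `1_{H > T}` of ★ `kernelBorelTail` / `constantTermTail` are
indicators of OPEN sets and Arthur's `k^T`, `Λ^T φ` are Borel functions once their ingredients are:

* `vecFinHeight_lastRow_mul_of_mem` — the finite local heights of the last row are invariant under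
  right multiplication by the open subgroup `U = {u : u_f ∈ GL_N(𝒪̂_E)}` (★
  `vecFinHeight_vecMul_eq_of_forall_mem`); hence `isLocallyConstant_finprod_vecFinHeight_lastRow` —
  the finite part `∏ᶠ_v h_v(e_N g)` of the height is LOCALLY CONSTANT on `G(𝔸_F)`;
* `continuous_vecArchNorm_lastRow` — the archimedean norms `‖e_N g‖_w` are continuous;
* `continuous_vecHeight_lastRow`, `vecHeight_lastRow_pos`, **`continuous_borelHeight`**,
  `isOpen_setOf_lt_borelHeight` (`{g : T < H(g)}` is open), `measurableSet_setOf_lt_borelHeight`.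

## References

* P. Garrett, *Modern Analysis of Automorphic Forms by Example* (2018), §2.2 (PDF pp. 81–83)
  [Garrett2018].
* C. Mœglin, J.-L. Waldspurger, *Spectral decomposition and Eisenstein series* (1995), I.2.2 (heights
  and their continuity) [MoeglinWaldspurger1995].
-/

noncomputable section

open NumberField IsDedekindDomain Topology Set Matrix
open scoped NNReal MatrixGroups

namespace Literature.NumberTheory.Automorphic

namespace UnitaryGroup

variable {F E : Type} [Field F] [NumberField F] [Field E] [NumberField E] [Algebra F E]
  {c : E ≃ₐ[F] E} {N : ℕ} [NeZero N]

/-! ## §1 The finite part of the height is locally constant -/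

/-- **The finite local heights of the last row are unchanged by right multiplication by an element
whose finite part lies in `GL_N(𝒪̂_E)`**: `h_v(e_N (g u)) = h_v(e_N g)` for all finite `v`
(`e_N (g u) = (e_N g) u`, ★ `lastRow_mul`, and `h_v(x u) = h_v(x)` for `u, u⁻¹` `v`-integral,
★ `vecFinHeight_vecMul_eq_of_forall_mem`; Garrett (2018), §2.2: «the isometry groups of the `h_v`
are the compact subgroups `K_v`»). [cite: Garrett2018, §2.2 (PDF p. 81)] -/
theorem vecFinHeight_lastRow_mul_of_mem (g : (quasiSplit F E c N).Adelic) {u : (quasiSplit F E c N).Adelic}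
    (hu : GLn.sndHom N E (adelicVal F E c N _ u) ∈ glFiniteIntegralLevel N E)
    (v : HeightOneSpectrum (𝓞 E)) :
    vecFinHeight E v (lastRow (g * u)) = vecFinHeight E v (lastRow g) := by
  classical
  rw [lastRow_mul]
  obtain ⟨h1, h2⟩ := mem_glFiniteIntegralLevel_iff.1 hu
  refine vecFinHeight_vecMul_eq_of_forall_mem v (lastRow g) (adelicVal F E c N _ u)
    (fun i j => ?_) (fun i j => ?_)
  · exact (mem_integralFiniteAdeles_iff.1 (h1 i j)) v
  · have h2' := h2 i j
    rw [← map_inv] at h2'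
    exact (mem_integralFiniteAdeles_iff.1 h2') v

/-- **The finite part `∏ᶠ_v h_v(e_N g)` of the height is locally constant on `G(𝔸_F)`**: it is
constant on each coset `g U` of the OPEN subgroup `U = {u : u_f ∈ GL_N(𝒪̂_E)}` (★
`isOpen_glFiniteIntegralLevel`, continuity of `g ↦ g_f`). [cite: Garrett2018, §2.2 (PDF p. 82)] -/
theorem isLocallyConstant_finprod_vecFinHeight_lastRow :
    IsLocallyConstant fun g : (quasiSplit F E c N).Adelic => ∏ᶠ v, vecFinHeight E v (lastRow g) := by
  -- the open subgroup `U`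
  let U : Subgroup (quasiSplit F E c N).Adelic :=
    ((glFiniteIntegralLevel N E).comap (GLn.sndHom N E)).comap (adelicVal F E c N _)
  have hUo : IsOpen (U : Set (quasiSplit F E c N).Adelic) := by
    have hc : Continuous fun g : (quasiSplit F E c N).Adelic => GLn.sndHom N E (adelicVal F E c N _ g) :=
      (continuous_snd.generalLinearGroup_map).comp continuous_subtype_val
    exact (isOpen_glFiniteIntegralLevel N E).preimage hc
  refine (IsLocallyConstant.iff_exists_open _).2 fun g => ⟨(fun u => g * u) '' (U : Set _), ?_, ?_, ?_⟩
  · -- `g U` is open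
    exact (Homeomorph.mulLeft g).isOpenMap _ hUo
  · exact ⟨1, U.one_mem, mul_one g⟩
  · rintro _ ⟨u, hu, rfl⟩
    exact finprod_congr fun v => vecFinHeight_lastRow_mul_of_mem g hu v

/-- Hence the finite part of the height is continuous. [cite: Garrett2018, §2.2 (PDF p. 82)] -/
theorem continuous_finprod_vecFinHeight_lastRow :
    Continuous fun g : (quasiSplit F E c N).Adelic => ∏ᶠ v, vecFinHeight E v (lastRow g) :=
  isLocallyConstant_finprod_vecFinHeight_lastRow.continuous

/-! ## §2 The archimedean part and the height are continuous -/

/-- The entries of the last row depend continuously on `g`. [cite: Garrett2018, §2.2 (PDF p. 83)] -/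
theorem continuous_lastRow_apply (j : Fin N) :
    Continuous fun g : (quasiSplit F E c N).Adelic => lastRow g j :=
  ((Units.continuous_val.comp continuous_subtype_val).matrix_elem ⊤ j)

/-- **The archimedean norms `‖e_N g‖_w` are continuous in `g`** (Euclidean norms of the continuous
archimedean components of the last row). [cite: Garrett2018, §2.2 (PDF p. 81)] -/
theorem continuous_vecArchNorm_lastRow (w : InfinitePlace E) :
    Continuous fun g : (quasiSplit F E c N).Adelic => vecArchNorm E w (lastRow g) := by
  unfold vecArchNorm
  refine NNReal.continuous_sqrt.comp (continuous_finsetSum _ fun i _ => ?_)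
  refine (Continuous.nnnorm ?_).pow 2
  -- `g ↦ (lastRow g i).1 w`: the `w`-component of the archimedean part of an entry
  exact (continuous_apply w).comp (continuous_fst.comp (continuous_lastRow_apply i))

/-- **The Godement–Garrett height of the last row is continuous on `U(J_N)(𝔸_F)`**
(`h = ∏_w ‖·‖_w^{mult w} · ∏ᶠ_v h_v`: a finite product of continuous archimedean factors times the
locally constant finite part). [cite: Garrett2018, §2.2 (PDF p. 82)] -/
theorem continuous_vecHeight_lastRow :
    Continuous fun g : (quasiSplit F E c N).Adelic => vecHeight E (lastRow g) := by
  unfold vecHeight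
  exact (continuous_finsetProd _ fun w _ => (continuous_vecArchNorm_lastRow w).pow _).mul
    continuous_finprod_vecFinHeight_lastRow

/-- The height of the last row is positive (`e_N g = e_N · g` is a primitive vector of the lattice
`E^N g`, ★ `vecHeight_ratVec_vecMul_pos`). [cite: Garrett2018, Cor. 3.3.3 (PDF p. 163)] -/
theorem vecHeight_lastRow_pos (g : (quasiSplit F E c N).Adelic) : 0 < vecHeight E (lastRow g) := by
  classical
  have hN : N = (N - 1) + 1 := (Nat.succ_pred_eq_of_pos (Nat.pos_of_ne_zero (NeZero.ne N))).symm
  have hξ : (Pi.single (⊤ : Fin N) (1 : E) : Fin N → E) ≠ 0 := by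
    intro h
    have := congrFun h ⊤
    rw [Pi.single_eq_same, Pi.zero_apply] at this
    exact one_ne_zero this
  have h := one_le_vecHeight_principalVec (K := E) hξ
  -- `1 ≤ h(e_N)` and `1 ≤ H_mat(g⁻¹) h(e_N g)` (★ `one_le_matHeightBound_mul_vecHeight`) give positivity
  have h2 := one_le_matHeightBound_mul_vecHeight (K := E) hξ (adelicVal F E c N _ g)
  rw [lastRow_eq_principalVec_vecMul]
  by_contra h0
  rw [not_lt, nonpos_iff_eq_zero] at h0
  rw [h0, mul_zero] at h2
  exact not_lt.2 h2 zero_lt_one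

/-- **The Borel height `H(g) = h(e_N g)⁻¹` is continuous on `U(J_N)(𝔸_F)`** (Mœglin–Waldspurger
(1995), I.2.2; Garrett (2018), §2.2). [cite: MoeglinWaldspurger1995, I.2.2] -/
theorem continuous_borelHeight : Continuous (borelHeight : (quasiSplit F E c N).Adelic → ℝ≥0) := by
  have h : (borelHeight : (quasiSplit F E c N).Adelic → ℝ≥0) = fun g => (vecHeight E (lastRow g))⁻¹ :=
    funext fun g => borelHeight_def g
  rw [h]
  exact continuous_vecHeight_lastRow.inv₀ fun g => (vecHeight_lastRow_pos g).ne'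

/-- **The cut-off sets `{g : T < H(g)}` of Arthur's truncation are open.** [cite: MoeglinWaldspurger1995, I.2.2] -/
theorem isOpen_setOf_lt_borelHeight (T : ℝ≥0) :
    IsOpen {g : (quasiSplit F E c N).Adelic | T < borelHeight g} :=
  isOpen_lt continuous_const continuous_borelHeight

/-- The cut-off sets `{g : ¬ T < H(g)} = {H ≤ T}` are closed. [cite: MoeglinWaldspurger1995, I.2.2] -/
theorem isClosed_setOf_borelHeight_le (T : ℝ≥0) :
    IsClosed {g : (quasiSplit F E c N).Adelic | borelHeight g ≤ T} :=
  isClosed_le continuous_borelHeight continuous_const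

/-- The cut-off sets are Borel measurable. [cite: MoeglinWaldspurger1995, I.2.2] -/
theorem measurableSet_setOf_lt_borelHeight [MeasurableSpace (quasiSplit F E c N).Adelic]
    [BorelSpace (quasiSplit F E c N).Adelic] (T : ℝ≥0) :
    MeasurableSet {g : (quasiSplit F E c N).Adelic | T < borelHeight g} :=
  (isOpen_setOf_lt_borelHeight T).measurableSet

/-- The Borel height is Borel measurable. [cite: MoeglinWaldspurger1995, I.2.2] -/
theorem measurable_borelHeight [MeasurableSpace (quasiSplit F E c N).Adelic]
    [BorelSpace (quasiSplit F E c N).Adelic] :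
    Measurable (borelHeight : (quasiSplit F E c N).Adelic → ℝ≥0) :=
  continuous_borelHeight.measurable

end UnitaryGroup

end Literature.NumberTheory.Automorphic
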